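import Literature.Analysis.FunctionSpaces.TorusClassicalNSFirstRemainderV

/-!
# The first linearisation remainder in `V` with integrable coefficients (tools stub
# `stub_firstRemainderIntCoeffTools` of block N-R, line `ergodic-budget-selection-closing`,
# crux `BaireTransfer.DenseLoudDesignerForces`, stmt-AnomalousDissipation-1143)

Summit-side wrapper, at `d = Fin 3`, of the Literature estimate
`Literature.Analysis.FunctionSpaces.Torus.IsClassicalNSSolutionOn.h1_sub_sub_le_mul_sq_of_integral_laplacian_sq_le`
(`Literature/Analysis/FunctionSpaces/TorusClassicalNSFirstRemainderV.lean`): for `ν > 0`, `M₁`, `Y` and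
`τ > 0` there is `K = K(ν, M₁, Y, τ)` such that for any two classical solutions `u₁, u₂` of NS_ν on
`[a, a + τ] × T³` with the same force, zero-mean slices, `‖∇uᵢ(t)‖₂² ≤ M₁` and
`∫ₐ^{a+τ} ‖Δuᵢ‖₂² ≤ Y`, and the smooth divergence-free zero-mean solution `w` of the linearised
equation along `u₁` with `w(a) = (u₂ − u₁)(a)`, the remainder `r = u₂ − u₁ − w` satisfies
`‖r(t)‖²_{L²} + ‖∇r(t)‖₂² ≤ K (‖(u₂ − u₁)(a)‖²_{L²} + ‖∇(u₂ − u₁)(a)‖₂²)²` on `[a, a + τ]` — the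
`V`-data version (no sup norm of `uᵢ`, `∂uᵢ`) of the landed sup-norm-coefficient remainder estimate
`Torus.IsClassicalNSSolutionOn.exists_h1_sub_sub_le`, i.e. the first-order Taylor remainder of the
`C²` dependence of the solution map `V → V` at `V`-data base points (block N-R of the smooth-model
construction).  The mathematics (`r` solves the forced linearised equation with source `−(δ·∇)δ`;
`V`-growth of the forced linearised flow `stub_linearisedForcedVGrowthTools`; the source bound
`∫‖(δ·∇)δ‖² ≤ c‖∇δ‖₂²‖Δδ‖₂²`; `V`-stability `stub_vStabilityTools` and its dissipation integral
`∫ₐᵗ‖Δδ‖₂² ≤ C H₀`) is in the Literature files; only the bound `∫ₐ^{a+τ} ‖Δu₁‖₂² ≤ Y` of the BASE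
solution is used, the registered twin bound on `u₂` is carried for symmetry.

References: Constantin–Foias, *Navier–Stokes Equations* (1988) Ch. 14, Lemma 14.3 (14.10);
Ch. 10, Thm. 10.2 (10.7).
-/

-- `Summit.<Summit>.<Problem>` is the tree's mandated summit-side namespace (CONVENTIONS §2); for this
-- single-conjunct summit the two coincide, so the duplicate is deliberate.
set_option linter.dupNamespace false

noncomputable section

open scoped BigOperators Topology ENNReal InnerProductSpace
open Filter Set Function MeasureTheory

namespace Summit.AnomalousDissipation.AnomalousDissipation.Theorems.DenseLoudDesignerForces.Ergodic

open Literature.Analysis.FunctionSpaces Literature.Analysis.FunctionSpaces.Torus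
open Literature.Analysis.FluidPDE Literature.Analysis.FluidPDE.Torus

/-- **Tools stub N-R2′ — the first-order (linearisation) remainder in `V` with integrable
coefficients** (registered tools stub `stub_firstRemainderIntCoeffTools` of block N, crux
stmt-AnomalousDissipation-1143, line `ergodic-budget-selection-closing`).  For `ν > 0` and `M₁, Y, τ`
(`τ > 0`) there is `K` such that for any two classical solutions `u₁, u₂` of NS_ν (same force) on
`[a, a + τ] × T³` with zero-mean slices, `‖∇uᵢ(t)‖₂² ≤ M₁` on the interval and
`∫ₐ^{a+τ} ‖Δuᵢ(s)‖₂² ds ≤ Y`, and every jointly smooth `(w, q)` with `div w = 0`, `∫ w = 0`,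
`∂ₜw + (u₁·∇)w + (w·∇)u₁ = νΔw − ∇q` on `[a, a + τ] × T³` and `w(a) = (u₂ − u₁)(a)`, the remainder
`r = u₂ − u₁ − w` obeys `∫‖r(t)‖² + ‖∇r(t)‖₂² ≤ K (∫‖(u₂ − u₁)(a)‖² + ‖∇(u₂ − u₁)(a)‖₂²)²` for all
`t ∈ [a, a + τ]`
(`Torus.IsClassicalNSSolutionOn.h1_sub_sub_le_mul_sq_of_integral_laplacian_sq_le` at `d = Fin 3`;
Constantin–Foias 1988, Lemma 14.3 (14.10), in `V` along strong solutions).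
[cite: ConstantinFoiasNSE1988, Ch. 14 Lemma 14.3 (14.10)] -/
theorem stub_firstRemainderIntCoeffTools {ν : ℝ} (hν : 0 < ν) (M₁ Y τ : ℝ) (hτ : 0 < τ) :
    ∃ K : ℝ, ∀ {a : ℝ} {f u₁ u₂ w : ℝ → (UnitAddTorus (Fin 3)) → (EuclideanSpace ℝ (Fin 3))} {p₁ p₂ q : ℝ → (UnitAddTorus (Fin 3)) → ℝ},
      IsClassicalNSSolutionOn (Icc a (a + τ)) ν f u₁ p₁ → IsClassicalNSSolutionOn (Icc a (a + τ)) ν f u₂ p₂ →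
      (∀ t ∈ Icc a (a + τ), HasZeroMean (u₁ t)) → (∀ t ∈ Icc a (a + τ), HasZeroMean (u₂ t)) →
      (∀ t ∈ Icc a (a + τ), gradNormSq (u₁ t) ≤ M₁) → (∀ t ∈ Icc a (a + τ), gradNormSq (u₂ t) ≤ M₁) →
      (∫ s in a..(a + τ), (∫ x, ‖laplacian (u₁ s) x‖ ^ 2) ≤ Y) → (∫ s in a..(a + τ), (∫ x, ‖laplacian (u₂ s) x‖ ^ 2) ≤ Y) →
      IsSmoothSpaceTimeOn (Icc a (a + τ)) w → IsSmoothSpaceTimeOn (Icc a (a + τ)) q →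
      (∀ t ∈ Icc a (a + τ), IsDivFree (w t)) → (∀ t ∈ Icc a (a + τ), HasZeroMean (w t)) →
      (∀ t ∈ Icc a (a + τ), ∀ x, Torus.timeDerivWithin (Icc a (a + τ)) w t x + convect (u₁ t) (w t) x + convect (w t) (u₁ t) x =
        ν • laplacian (w t) x - Torus.gradient (q t) x) → (∀ y, w a y = u₂ a y - u₁ a y) →
      ∀ t ∈ Icc a (a + τ), (∫ x, ‖u₂ t x - u₁ t x - w t x‖ ^ 2) + gradNormSq (fun y => u₂ t y - u₁ t y - w t y) ≤
        K * ((∫ x, ‖u₂ a x - u₁ a x‖ ^ 2) + gradNormSq (fun y => u₂ a y - u₁ a y)) ^ 2 := by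
  obtain ⟨K, hK⟩ :=
    IsClassicalNSSolutionOn.h1_sub_sub_le_mul_sq_of_integral_laplacian_sq_le (d := Fin 3)
      (Fintype.card_fin 3) hν M₁ Y τ hτ
  exact ⟨K, fun h₁ h₂ hz₁ hz₂ hG₁ hG₂ hY₁ _ hw hq hwdiv hwz hlin h0 =>
    hK h₁ h₂ hz₁ hz₂ hG₁ hG₂ hY₁ hw hq hwdiv hwz hlin h0⟩

end Summit.AnomalousDissipation.AnomalousDissipation.Theorems.DenseLoudDesignerForces.Ergodic

end
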